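import Literature.NumberTheory.Automorphic.AdelicGroupDataQuotientClosed
import Literature.NumberTheory.Automorphic.AdelicGroupDataGLnProofs
import Literature.NumberTheory.Automorphic.GLnAdelicLocallyCompact
import Literature.NumberTheory.Automorphic.AdelicSecondCountable
import HarnessLib

/-!
# `A_G · G(K)` is unimodular: its Haar measures are right invariant (`GL_n`, `D^×`)

Topic `NumberTheory/Automorphic`; theorems only (no definition, no named fact, no instance).

For an adelic group datum `𝒢` (`AdelicGroupData`) with a continuous *central retraction*
`θ : G(𝔸_K) →* G(𝔸_K)` onto `A_G` (values in `A_G`, the identity on `A_G`, trivial on `G(K)`; it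
exists for `GL_n`, `exists_centralRetraction_gl`, and for `D^×`, `exists_centralRetraction_units`)
and discrete `G(K)`, the subgroup `H = A_G · G(K)` is `A_G × G(K)` (abelian times discrete), hence
**unimodular**. We prove this in the form needed by the kernel of `R(f)` on
`L²(G(𝔸_K) ⧸ A_G G(K))` (`AutomorphicQuotientKernel` and its continuation, where the kernel
`K_f(x, y) = ∫_H f(x̃ h⁻¹ ỹ⁻¹) dρ(h)` descends to `X × X` exactly when the Haar measure `ρ` of `H`
is also right invariant):

* `AdelicGroupData.isOpen_setOf_coe_mem_center'` — **`A_G` is (relatively) open in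
  `A_G · G(K)`**: for `h ∈ H`, `θ(h)⁻¹ h ∈ G(K)` (`mem_quotientSubgroup_iff_of_centralRetraction`)
  and `h ∈ A_G ↔ θ(h)⁻¹ h = 1`, so `A_G ∩ H` is the preimage of the isolated point `1` of the
  discrete `G(K)` under the continuous map `h ↦ θ(h)⁻¹ h`.
* `AdelicGroupData.isMulRightInvariant_of_centralRetraction` — **every Haar measure `ρ` on
  `H = A_G · G(K)` is right invariant.** Proof: `U = A_G ∩ C` (`C` a compact neighbourhood of `1`
  in `H`) has `0 < ρ(U) < ∞` by the previous item, and consists of *central* elements, so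
  `U h = h U` for every `h ∈ H`; the left invariant measure `(· h)_* ρ` is `c • ρ` (uniqueness,
  Mathlib `isMulLeftInvariant_eq_smul`) and evaluating on `U h` gives `ρ(U) = c ρ(h U) = c ρ(U)`,
  i.e. `c = 1`. (Equivalently: the modular function of `H` is trivial on the centre and on the
  open subgroup's normaliser; Weil, *L'intégration…* (1940), §8; Folland (1995), Prop. 2.26 ff.)
* Honest instances: `AdelicGroupData.isMulRightInvariant_quotientSubgroup_gl` (`H ≤ GL_n(𝔸_K)`)
  and `AdelicGroupData.isMulRightInvariant_quotientSubgroup_units` (`H = ℝ_{>0} · Dˣ ≤ D_𝔸ˣ` for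
  a finite-dimensional `K`-algebra `D ≠ 0`), for any Borel structure on the adelic group.

Part of the inline (D-0026) decomposition of the named fact
`Literature.NumberTheory.Automorphic.strong_multiplicity_one_quaternionUnits` (Gelbart (1975),
Thm. 10.5 (ii): the `D^×` side of the trace-formula comparison, (10.14) = Remark 9.23).

## References

* G. B. Folland, *A Course in Abstract Harmonic Analysis* (1995), §2.4 (modular function;
  unimodularity of abelian, discrete and compact groups) [Folland1995].
* A. Weil, *Basic Number Theory* (1967), Ch. IV §4 (the splitting `G_A = G_A¹ × M`) [WeilBNT1967].
* S. Gelbart, *Automorphic forms on adele groups* (1975), Remark 9.23, (10.14) [Gelbart1975].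
-/

noncomputable section

open MeasureTheory Measure NumberField IsDedekindDomain Topology
open scoped ENNReal NNReal TensorProduct

namespace Literature.NumberTheory.Automorphic

namespace AdelicGroupData

universe u

section General

variable {K : Type} [Field K] [NumberField K] (𝒢 : AdelicGroupData.{u} K)

/-- **`A_G` is relatively open in `A_G · G(K)`** when `G(K)` is discrete and a continuous central
retraction `θ` exists: `{h ∈ H | h ∈ A_G}` is the preimage of the isolated point `1 ∈ G(K)` under
`h ↦ θ(h)⁻¹ h` (which maps `H` into `G(K)`, `mem_quotientSubgroup_iff_of_centralRetraction`).
[folklore] -/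
theorem isOpen_setOf_coe_mem_center' (hdisc : 𝒢.IsDiscreteRational)
    (θ : 𝒢.Adelic →* 𝒢.Adelic) (hθc : Continuous θ) (hθA : ∀ g, θ g ∈ 𝒢.center')
    (hθa : ∀ a ∈ 𝒢.center', θ a = a) (hθγ : ∀ γ ∈ 𝒢.arithmeticSubgroup, θ γ = 1) :
    IsOpen {h : 𝒢.quotientSubgroup | (h : 𝒢.Adelic) ∈ 𝒢.center'} := by
  have hq : ∀ h : 𝒢.quotientSubgroup, (θ h)⁻¹ * (h : 𝒢.Adelic) ∈ 𝒢.arithmeticSubgroup := fun h =>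
    (mem_quotientSubgroup_iff_of_centralRetraction 𝒢 θ hθA hθa hθγ h).1 h.2
  haveI : DiscreteTopology 𝒢.arithmeticSubgroup := hdisc
  -- an open `V ⊆ G(𝔸_K)` with `V ∩ G(K) = {1}`
  obtain ⟨V, hVo, hV⟩ : ∃ V : Set 𝒢.Adelic, IsOpen V ∧
      ((↑) : 𝒢.arithmeticSubgroup → 𝒢.Adelic) ⁻¹' V = {1} := by
    obtain ⟨V, hVo, hV⟩ := isOpen_induced_iff.1 (isOpen_discrete ({1} : Set 𝒢.arithmeticSubgroup))
    exact ⟨V, hVo, hV⟩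
  have key : ∀ g ∈ 𝒢.arithmeticSubgroup, (g ∈ V ↔ g = 1) := by
    intro g hg
    have h1 : ((⟨g, hg⟩ : 𝒢.arithmeticSubgroup) ∈
        ((↑) : 𝒢.arithmeticSubgroup → 𝒢.Adelic) ⁻¹' V) ↔
        ((⟨g, hg⟩ : 𝒢.arithmeticSubgroup) ∈ ({1} : Set 𝒢.arithmeticSubgroup)) := by rw [hV]
    rw [Set.mem_preimage, Set.mem_singleton_iff] at h1
    rw [h1]
    constructor
    · intro h; exact congrArg Subtype.val h
    · intro h; exact Subtype.ext h
  have hset : {h : 𝒢.quotientSubgroup | (h : 𝒢.Adelic) ∈ 𝒢.center'} =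
      (fun h : 𝒢.quotientSubgroup => (θ h)⁻¹ * (h : 𝒢.Adelic)) ⁻¹' V := by
    ext h
    simp only [Set.mem_setOf_eq, Set.mem_preimage]
    rw [key _ (hq h)]
    constructor
    · intro ha
      rw [hθa _ ha, inv_mul_cancel]
    · intro h1
      have h2 : θ h = (h : 𝒢.Adelic) := inv_mul_eq_one.1 h1
      rw [← h2]
      exact hθA _
  rw [hset]
  exact hVo.preimage ((hθc.comp continuous_subtype_val).inv.mul continuous_subtype_val)

/-- **`A_G · G(K)` is unimodular**: every Haar measure on the closed subgroup `H = A_G · G(K)` of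
`G(𝔸_K)` (for a datum with `G(𝔸_K)` locally compact, second countable and Hausdorff, `G(K)`
discrete, and a continuous central retraction `θ`) is also *right* invariant. With
`U = {h ∈ H | h ∈ A_G} ∩ C`, `C` a compact neighbourhood of `1` in `H`: `0 < ρ(U) < ∞`
(`isOpen_setOf_coe_mem_center'`), `U` consists of central elements so `U h = h U`, and the left
invariant measure `(· h)_* ρ = c • ρ` (Mathlib `isMulLeftInvariant_eq_smul`) gives on `U h` the
identity `ρ(U) = c ρ(U)`, whence `c = 1`. (Folland (1995), §2.4: abelian and discrete groups are
unimodular; here `H ≅ A_G × G(K)`.) [cite: Folland1995, §2.4] -/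
theorem isMulRightInvariant_of_centralRetraction [LocallyCompactSpace 𝒢.Adelic]
    [SecondCountableTopology 𝒢.Adelic] [T2Space 𝒢.Adelic] [MeasurableSpace 𝒢.Adelic]
    [BorelSpace 𝒢.Adelic] (hdisc : 𝒢.IsDiscreteRational) (θ : 𝒢.Adelic →* 𝒢.Adelic)
    (hθc : Continuous θ) (hθA : ∀ g, θ g ∈ 𝒢.center') (hθa : ∀ a ∈ 𝒢.center', θ a = a)
    (hθγ : ∀ γ ∈ 𝒢.arithmeticSubgroup, θ γ = 1) (ρ : Measure 𝒢.quotientSubgroup)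
    [IsHaarMeasure ρ] : ρ.IsMulRightInvariant := by
  have hHc : IsClosed (𝒢.quotientSubgroup : Set 𝒢.Adelic) :=
    isClosed_quotientSubgroup_of_centralRetraction 𝒢 hdisc θ hθc hθA hθa hθγ
  haveI : LocallyCompactSpace 𝒢.quotientSubgroup :=
    hHc.isClosedEmbedding_subtypeVal.locallyCompactSpace
  haveI : SecondCountableTopology 𝒢.quotientSubgroup :=
    TopologicalSpace.Subtype.secondCountableTopology _
  -- the test set `U`
  set A : Set 𝒢.quotientSubgroup := {h | (h : 𝒢.Adelic) ∈ 𝒢.center'} with hA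
  have hAo : IsOpen A := isOpen_setOf_coe_mem_center' 𝒢 hdisc θ hθc hθA hθa hθγ
  have h1A : (1 : 𝒢.quotientSubgroup) ∈ A := 𝒢.center'.one_mem
  obtain ⟨C, hCc, hC1⟩ := exists_compact_mem_nhds (1 : 𝒢.quotientSubgroup)
  set U : Set 𝒢.quotientSubgroup := A ∩ C with hU
  have hUm : MeasurableSet U := hAo.measurableSet.inter hCc.isClosed.measurableSet
  have hUtop : ρ U ≠ ∞ :=
    ((measure_mono Set.inter_subset_right).trans_lt hCc.measure_lt_top).ne
  have hUpos : ρ U ≠ 0 := by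
    have h : 0 < ρ (A ∩ interior C) :=
      (hAo.inter isOpen_interior).measure_pos ρ ⟨1, h1A, mem_interior_iff_mem_nhds.2 hC1⟩
    exact (h.trans_le (measure_mono (Set.inter_subset_inter_right _ interior_subset))).ne'
  -- elements of `U` are central
  have hcomm : ∀ u ∈ U, ∀ h : 𝒢.quotientSubgroup, u * h = h * u := by
    intro u hu h
    refine Subtype.ext ?_
    change (u : 𝒢.Adelic) * h = h * u
    exact (Subgroup.mem_center_iff.1 (𝒢.center'_le hu.1) h).symm
  refine ⟨fun h => ?_⟩
  -- `(· h)_* ρ = c • ρ`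
  have hcρ := isMulLeftInvariant_eq_smul (Measure.map (· * h) ρ) ρ
  set c : ℝ≥0 := haarScalarFactor (Measure.map (· * h) ρ) ρ with hc
  -- evaluate on `U h = h U`
  have hpre₁ : (fun x => x * h) ⁻¹' ((fun x => x * h⁻¹) ⁻¹' U) = U := by
    ext x
    simp only [Set.mem_preimage, mul_inv_cancel_right]
  have hpre₂ : (fun x => x * h⁻¹) ⁻¹' U = (fun x => h⁻¹ * x) ⁻¹' U := by
    ext x
    simp only [Set.mem_preimage]
    constructor
    · intro hx
      have e : h⁻¹ * x = x * h⁻¹ := by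
        have := hcomm _ hx h
        -- `x h⁻¹` central: `x h⁻¹ · h = h · x h⁻¹`, i.e. `x = h x h⁻¹`
        calc h⁻¹ * x = h⁻¹ * (x * h⁻¹ * h) := by rw [inv_mul_cancel_right]
          _ = h⁻¹ * (h * (x * h⁻¹)) := by rw [this]
          _ = x * h⁻¹ := by rw [inv_mul_cancel_left]
      rwa [e]
    · intro hx
      have e : x * h⁻¹ = h⁻¹ * x := by
        have := hcomm _ hx h
        calc x * h⁻¹ = h * (h⁻¹ * x) * h⁻¹ := by rw [mul_inv_cancel_left]
          _ = h⁻¹ * x * h * h⁻¹ := by rw [← this]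
          _ = h⁻¹ * x := by rw [mul_inv_cancel_right]
      rwa [e]
  have hSm : MeasurableSet ((fun x => x * h⁻¹) ⁻¹' U) := measurable_mul_const h⁻¹ hUm
  have hval : ρ U = c * ρ U := by
    have e1 := congrArg (fun m : Measure 𝒢.quotientSubgroup => m ((fun x => x * h⁻¹) ⁻¹' U)) hcρ
    simp only [Measure.smul_apply] at e1
    rw [Measure.map_apply (measurable_mul_const h) hSm, hpre₁, hpre₂, measure_preimage_mul,
      ENNReal.smul_def, smul_eq_mul] at e1
    exact e1
  have hc1 : c = 1 := by
    have h2 : (1 : ℝ≥0∞) * ρ U = (c : ℝ≥0∞) * ρ U := by rwa [one_mul]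
    have h3 := (ENNReal.mul_left_inj hUpos hUtop).1 h2
    exact_mod_cast h3.symm
  rw [hcρ, hc1, one_smul]

end General

/-! ### Honest instances: `GL_n` and `D^×` -/

section Instances

/-- **`A_G · GL_n(K)` is unimodular**: every Haar measure on the closed subgroup
`A_G · GL_n(K) ≤ GL_n(𝔸_K)` is right invariant (central retraction `exists_centralRetraction_gl`,
discreteness `gl_isDiscreteRational_holds`; any Borel structure on `GL_n(𝔸_K)`).
[cite: Folland1995, §2.4] -/
theorem isMulRightInvariant_quotientSubgroup_gl (n : ℕ) (K : Type) [Field K] [NumberField K]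
    [MeasurableSpace (AdelicGroupData.gl n K).Adelic] [BorelSpace (AdelicGroupData.gl n K).Adelic]
    (ρ : Measure (AdelicGroupData.gl n K).quotientSubgroup) [IsHaarMeasure ρ] :
    ρ.IsMulRightInvariant := by
  haveI : LocallyCompactSpace (AdelicGroupData.gl n K).Adelic :=
    locallyCompactSpace_gl_adelic_holds n K
  haveI : SecondCountableTopology (AdelicGroupData.gl n K).Adelic :=
    secondCountableTopology_gl_adelic n K
  haveI : T2Space (AdelicGroupData.gl n K).Adelic := t2Space_gl n K
  obtain ⟨θ, hθc, hθA, hθa, hθγ⟩ := exists_centralRetraction_gl n K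
  exact isMulRightInvariant_of_centralRetraction (AdelicGroupData.gl n K)
    (gl_isDiscreteRational_holds n K) θ hθc hθA hθa hθγ ρ

universe v

/-- **`ℝ_{>0} · Dˣ` is unimodular**: every Haar measure on the closed subgroup
`ℝ_{>0} · Dˣ ≤ D_𝔸ˣ` (`isClosed_quotientSubgroup_units`) is right invariant, for a
finite-dimensional `K`-algebra `D ≠ 0` (central retraction `exists_centralRetraction_units`,
discreteness `units_isDiscreteRational_holds`; any Borel structure on `D_𝔸ˣ`). This is the
two-sided invariance of `ρ` required to regard the kernel `K_f` of `R(f)` on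
`L²(D_𝔸ˣ ⧸ ℝ_{>0} Dˣ)` as a function on `X × X` (the `D^×` side of Gelbart's (10.14)).
[cite: Folland1995, §2.4] -/
theorem isMulRightInvariant_quotientSubgroup_units (K : Type) [Field K] [NumberField K]
    (D : Type v) [Ring D] [Algebra K D] [Module.Finite K D] [Nontrivial D]
    [MeasurableSpace (AdelicGroupData.units K D).Adelic]
    [BorelSpace (AdelicGroupData.units K D).Adelic]
    (ρ : Measure (AdelicGroupData.units K D).quotientSubgroup) [IsHaarMeasure ρ] :
    ρ.IsMulRightInvariant := by
  haveI : LocallyCompactSpace (AdeleRing (𝓞 K) K) := locallyCompactSpace_adeleRing' K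
  haveI : T2Space (AdeleRing (𝓞 K) K) := t2Space_adeleRing K
  haveI i₁ : LocallyCompactSpace (adelicUnits K D) := inferInstance
  haveI i₂ : T2Space (adelicUnits K D) := t2Space_adelicUnits K D
  haveI i₃ : SecondCountableTopology (adelicUnits K D) := by
    haveI : SecondCountableTopology (AdeleRing (𝓞 K) K) := secondCountableTopology_adeleRing K
    haveI : SecondCountableTopology (ScalarExtension K (AdeleRing (𝓞 K) K) D) :=
      (ScalarExtension.coordHomeomorph K (AdeleRing (𝓞 K) K) D).secondCountableTopology
    haveI : SecondCountableTopology (ScalarExtension K (AdeleRing (𝓞 K) K) D)ᵐᵒᵖ :=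
      MulOpposite.opHomeomorph.symm.secondCountableTopology
    exact Units.isEmbedding_embedProduct.secondCountableTopology
  haveI : LocallyCompactSpace (AdelicGroupData.units K D).Adelic := i₁
  haveI : T2Space (AdelicGroupData.units K D).Adelic := i₂
  haveI : SecondCountableTopology (AdelicGroupData.units K D).Adelic := i₃
  obtain ⟨θ, hθc, hθA, hθa, hθγ⟩ := exists_centralRetraction_units K D
  exact isMulRightInvariant_of_centralRetraction (AdelicGroupData.units K D)
    (AdelicGroupData.units_isDiscreteRational_holds K D) θ hθc hθA hθa hθγ ρ

end Instances

end AdelicGroupData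

end Literature.NumberTheory.Automorphic
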